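import Literature.NumberTheory.Sieve.HeathBrownCubicTypeII
import Mathlib.Data.Int.CardIntervalMod
import HarnessLib

/-!
# Lattice points of `ℤ[2^{1/3}]` in cubes: coordinates, residues, and the count `#{β̂ ∈ 𝒞 : I ∣ β} ≪ S₀³/N(I)`

Tool file (definitions with bodies + proofs, no named facts) for the decomposition of **Heath-Brown's
Type II estimate, Lemma 3.10** (`HeathBrown2001_lemma_3_10` of `HeathBrownCubicTypeII`), D. R.
Heath-Brown, *Primes represented by `x³ + 2y³`*, Acta Math. 186 (2001), 1–84.  The divisor-sum
estimates over cubes of §4 (Lemma 4.5, p. 23) and the residue-class sums of §§8, 13 rest on the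
identification `ℤ³ ≅ ℤ[2^{1/3}] = 𝓞_K`, `β̂ = (x, y, z) ↦ β = x + y·2^{1/3} + z·4^{1/3}` (the tree's
`coordElt`, `HeathBrownCubicTypeII`; `𝓞_K = ℤ[2^{1/3}]` is `adjoin_θint_eq_top` of `CubeRootTwoField`)
and on the elementary count used in the proof of Lemma 4.5: "if `𝒞'` is a cube of side `N(I)`, then
there are `O(N(I)²)` values of `β ∈ 𝒞'` for which `I ∣ β`" (p. 23).  This file PROVES:

* `pbZ`, `basis3` — the power basis `1, θ, θ²` of `𝓞_K` over `ℤ` (`PowerBasis.ofAdjoinEqTop'`), and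
  `coordElt_eq_sum_smul`, `coordElt_add`, `coordElt_sub`, `coordElt_smul`, `coordElt_injective`,
  `coordElt_surjective` (the coordinate map is a group isomorphism `ℤ³ ≅ 𝓞_K`);
* `modVec m` (componentwise residues in `[0, m)`), `cubeMod m = [0, m)³`, `coordElt_mem_iff_of_modEq`
  (membership in an ideal `I ∋ m` depends only on `β̂ mod m`);
* **`card_cubeMod_filter_mem_mul_absNorm`** — for `(m) ⊆ I`:
  `#{r ∈ [0,m)³ : coordElt r ∈ I} · N(I) = m³` (all fibres of `[0,m)³ → 𝓞_K/I` have the same size and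
  the map is onto);
* **`card_latticeCube_filter_le`** — a box count: an `m`-periodic property holds at no more than
  `#{r ∈ [0,m)³ : P r} · (⌊S₀/m⌋ + 1)³` points of a lattice cube of side `S₀`
  (`Int.Ioc_filter_modEq_card`);
* **`card_latticeCube_filter_mem_le`**, `card_latticeCube_filter_mem_le'` — the count of p. 23:
  `#{β̂ ∈ 𝒞 : β ∈ I} ≤ N(I)² (⌊S₀/N(I)⌋ + 1)³ ≤ 8 S₀³/N(I)` for `N(I) ≤ S₀`.

## References

* D. R. Heath-Brown, *Primes represented by `x³ + 2y³`*, Acta Math. 186 (2001), 1–84: proof of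
  Lemma 4.5, p. 23. [cite: HeathBrownActa2001, Lemma 4.5]

## Mathlib / tree search

Mathlib: `PowerBasis.ofAdjoinEqTop'` (`_gen`, `_dim`), `PowerBasis.basis`, `Basis.reindex`,
`Basis.equivFun`, `Int.Ioc_filter_modEq_card`, `Ideal.absNorm_mem`, `Ideal.finiteQuotientOfFreeOfNeBot`,
`Ideal.absNorm_apply`, `Submodule.cardQuot_apply`, `Finset.card_eq_sum_card_fiberwise`,
`Finset.card_le_mul_card_image`; nothing on lattice-point counts in ideals. Tree: `CubeRootTwoField`
(`θint`, `adjoin_θint_eq_top`, `minpoly_θint`, `cubicPoly_natDegree`), `HeathBrownCubicTypeII`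
(`coordElt`, `latticeCube`).
-/

noncomputable section

open Polynomial NumberField Finset

namespace Literature.NumberTheory.Sieve.CubicSieve

open LFunctions.CubeRootTwoField CubicPrimes

/-! ### The power basis `1, θ, θ²` of `𝓞_K` over `ℤ` and the coordinate map -/

/-- The power basis of `𝓞_K = ℤ[2^{1/3}]` over `ℤ` generated by `θ = 2^{1/3}`
(`adjoin_θint_eq_top`). [folklore] -/
def pbZ : PowerBasis ℤ (𝓞 K) :=
  PowerBasis.ofAdjoinEqTop' (RingOfIntegers.isIntegral θint) adjoin_θint_eq_top

/-- Its generator is `θ`. [folklore] -/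
theorem pbZ_gen : pbZ.gen = θint := PowerBasis.ofAdjoinEqTop'_gen _ _

/-- Its dimension is `3 = deg(X³ − 2)`. [folklore] -/
theorem pbZ_dim : pbZ.dim = 3 := by
  rw [pbZ, PowerBasis.ofAdjoinEqTop'_dim, minpoly_θint, cubicPoly_natDegree]

/-- The `ℤ`-basis `θ^i` (`i < 3`) of `𝓞_K`, indexed by `Fin 3`. [folklore] -/
def basis3 : Module.Basis (Fin 3) ℤ (𝓞 K) := pbZ.basis.reindex (finCongr pbZ_dim)

/-- `basis3 i = θ^i`. [folklore] -/
theorem basis3_apply (i : Fin 3) : basis3 i = θint ^ (i : ℕ) := by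
  rw [basis3, Module.Basis.reindex_apply, PowerBasis.coe_basis, pbZ_gen]
  simp

/-- The coordinate vector of `β̂ = (x, y, z)` as a function on `Fin 3`. [folklore] -/
def coordFun (v : ℤ × ℤ × ℤ) : Fin 3 → ℤ := ![v.1, v.2.1, v.2.2]

/-- `coordElt β̂ = ∑_i β̂_i • θ^i`. [folklore] -/
theorem coordElt_eq_sum_smul (v : ℤ × ℤ × ℤ) : coordElt v = ∑ i, coordFun v i • basis3 i := by
  rw [Fin.sum_univ_three, basis3_apply, basis3_apply, basis3_apply, coordElt]
  simp only [coordFun, Matrix.cons_val_zero, Matrix.cons_val_one, Matrix.cons_val,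
    Fin.val_zero, Fin.val_one, Fin.val_two, pow_zero, pow_one, zsmul_eq_mul, mul_one]

/-- `coordElt β̂ = basis3.equivFun⁻¹ (coordFun β̂)`. [folklore] -/
theorem coordElt_eq_equivFun_symm (v : ℤ × ℤ × ℤ) :
    coordElt v = basis3.equivFun.symm (coordFun v) := by
  rw [Module.Basis.equivFun_symm_apply, coordElt_eq_sum_smul]

/-- `coordFun` is a bijection `ℤ³ → (Fin 3 → ℤ)`. [folklore] -/
theorem coordFun_injective : Function.Injective coordFun := by
  intro v w h
  have h0 := congrFun h 0
  have h1 := congrFun h 1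
  have h2 := congrFun h 2
  simp only [coordFun, Matrix.cons_val_zero, Matrix.cons_val_one, Matrix.cons_val] at h0 h1 h2
  ext <;> assumption

/-- `coordFun` is onto. [folklore] -/
theorem coordFun_surjective : Function.Surjective coordFun := fun c =>
  ⟨(c 0, c 1, c 2), by ext i; fin_cases i <;> simp [coordFun]⟩

/-- Additivity of the coordinate map. [folklore] -/
theorem coordElt_add (v w : ℤ × ℤ × ℤ) : coordElt (v + w) = coordElt v + coordElt w := by
  simp only [coordElt, Prod.fst_add, Prod.snd_add, Int.cast_add]; ring

/-- The coordinate map on differences. [folklore] -/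
theorem coordElt_sub (v w : ℤ × ℤ × ℤ) : coordElt (v - w) = coordElt v - coordElt w := by
  simp only [coordElt, Prod.fst_sub, Prod.snd_sub, Int.cast_sub]; ring

/-- The coordinate map on integer multiples: `coordElt (n • β̂) = n · coordElt β̂`. [folklore] -/
theorem coordElt_smul (n : ℤ) (v : ℤ × ℤ × ℤ) : coordElt (n • v) = (n : 𝓞 K) * coordElt v := by
  simp only [coordElt, Prod.smul_fst, Prod.smul_snd, smul_eq_mul, Int.cast_mul]; ring

/-- **The coordinate map is injective** (`1, θ, θ²` are linearly independent over `ℤ`). [folklore] -/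
theorem coordElt_injective : Function.Injective (coordElt : ℤ × ℤ × ℤ → 𝓞 K) := by
  intro v w h
  rw [coordElt_eq_equivFun_symm, coordElt_eq_equivFun_symm] at h
  exact coordFun_injective (basis3.equivFun.symm.injective h)

/-- **The coordinate map is surjective** (`𝓞_K = ℤ[2^{1/3}] = ℤ + ℤθ + ℤθ²`). [folklore] -/
theorem coordElt_surjective : Function.Surjective (coordElt : ℤ × ℤ × ℤ → 𝓞 K) := by
  intro x
  obtain ⟨v, hv⟩ := coordFun_surjective (basis3.equivFun x)
  refine ⟨v, ?_⟩
  rw [coordElt_eq_equivFun_symm, hv, LinearEquiv.symm_apply_apply]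

/-! ### Residues modulo `m` -/

/-- Componentwise reduction of `β̂` modulo `m` into `[0, m)³`. [folklore] -/
def modVec (m : ℕ) (v : ℤ × ℤ × ℤ) : ℤ × ℤ × ℤ := (v.1 % m, v.2.1 % m, v.2.2 % m)

/-- The complete residue system `[0, m)³`. [folklore] -/
def cubeMod (m : ℕ) : Finset (ℤ × ℤ × ℤ) := Ico (0 : ℤ) m ×ˢ (Ico (0 : ℤ) m ×ˢ Ico (0 : ℤ) m)

/-- `#[0, m)³ = m³`. [folklore] -/
theorem card_cubeMod (m : ℕ) : #(cubeMod m) = m ^ 3 := by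
  simp only [cubeMod, card_product, Int.card_Ico, sub_zero, Int.toNat_natCast]; ring

/-- `modVec m β̂ ∈ [0, m)³` for `m ≥ 1`. [folklore] -/
theorem modVec_mem_cubeMod {m : ℕ} (hm : 0 < m) (v : ℤ × ℤ × ℤ) : modVec m v ∈ cubeMod m := by
  have hm' : (0 : ℤ) < m := by exact_mod_cast hm
  simp only [modVec, cubeMod, mem_product, mem_Ico]
  exact ⟨⟨Int.emod_nonneg _ hm'.ne', Int.emod_lt_of_pos _ hm'⟩,
    ⟨Int.emod_nonneg _ hm'.ne', Int.emod_lt_of_pos _ hm'⟩,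
    ⟨Int.emod_nonneg _ hm'.ne', Int.emod_lt_of_pos _ hm'⟩⟩

/-- `modVec` fixes `[0, m)³`. [folklore] -/
theorem modVec_eq_self_of_mem {m : ℕ} {v : ℤ × ℤ × ℤ} (hv : v ∈ cubeMod m) : modVec m v = v := by
  simp only [cubeMod, mem_product, mem_Ico] at hv
  obtain ⟨⟨h1, h1'⟩, ⟨h2, h2'⟩, ⟨h3, h3'⟩⟩ := hv
  simp only [modVec, Int.emod_eq_of_lt h1 h1', Int.emod_eq_of_lt h2 h2', Int.emod_eq_of_lt h3 h3']

/-- `β̂ − modVec m β̂ ∈ m ℤ³`. [folklore] -/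
theorem exists_sub_modVec_eq_smul (m : ℕ) (v : ℤ × ℤ × ℤ) : ∃ t : ℤ × ℤ × ℤ, v - modVec m v = (m : ℤ) • t := by
  refine ⟨(v.1 / m, v.2.1 / m, v.2.2 / m), ?_⟩
  have e1 := Int.emod_add_mul_ediv v.1 m
  have e2 := Int.emod_add_mul_ediv v.2.1 m
  have e3 := Int.emod_add_mul_ediv v.2.2 m
  ext <;> simp only [modVec, Prod.fst_sub, Prod.snd_sub, Prod.smul_fst, Prod.smul_snd, smul_eq_mul] <;>
    linarith

/-- `modVec` is `m`-periodic: `modVec (β̂ + m t) = modVec β̂`. [folklore] -/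
theorem modVec_add_smul (m : ℕ) (v t : ℤ × ℤ × ℤ) : modVec m (v + (m : ℤ) • t) = modVec m v := by
  ext <;> simp [modVec, Int.add_mul_emod_self_left]

/-- **Membership in an ideal containing `m` depends only on the residue of `β̂` modulo `m`**: if
`β̂ − β̂' ∈ mℤ³` then `β ∈ I ↔ β' ∈ I`. [folklore] -/
theorem coordElt_mem_iff_of_sub_eq_smul {m : ℕ} {I : Ideal (𝓞 K)} (hm : ((m : ℤ) : 𝓞 K) ∈ I)
    {v w t : ℤ × ℤ × ℤ} (h : v - w = (m : ℤ) • t) : coordElt v ∈ I ↔ coordElt w ∈ I := by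
  have hdiff : coordElt v - coordElt w ∈ I := by
    rw [← coordElt_sub, h, coordElt_smul]
    exact I.mul_mem_right _ hm
  constructor
  · intro hv
    have := I.sub_mem hv hdiff
    rwa [sub_sub_cancel] at this
  · intro hw
    have := I.add_mem hdiff hw
    rwa [sub_add_cancel] at this

/-- In particular `β ∈ I ↔ coordElt (modVec m β̂) ∈ I` when `m ∈ I`. [folklore] -/
theorem coordElt_mem_iff_modVec {m : ℕ} {I : Ideal (𝓞 K)} (hm : ((m : ℤ) : 𝓞 K) ∈ I)
    (v : ℤ × ℤ × ℤ) : coordElt v ∈ I ↔ coordElt (modVec m v) ∈ I := by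
  obtain ⟨t, ht⟩ := exists_sub_modVec_eq_smul m v
  exact coordElt_mem_iff_of_sub_eq_smul hm ht

/-! ### Residue classes of an ideal: `#{r ∈ [0,m)³ : coordElt r ∈ I} · N(I) = m³` -/

open scoped Classical in
/-- **Counting the residue classes of `I` modulo `m`** for an ideal `I ∋ m`, `m ≥ 1`:
`#{r ∈ [0,m)³ : coordElt r ∈ I} · N(I) = m³`.  The map `r ↦ coordElt r (mod I)` from `[0, m)³` to
`𝓞_K/I` is onto (`coordElt` is onto and `mℤ³ ↦ m𝓞_K ⊆ I`) and all its fibres have the cardinality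
of the fibre of `0` (translate by `r₀` and reduce modulo `m`), while `#(𝓞_K/I) = N(I)`. [folklore] -/
theorem card_cubeMod_filter_mem_mul_absNorm {m : ℕ} (hm : 0 < m) {I : Ideal (𝓞 K)}
    (hmI : ((m : ℤ) : 𝓞 K) ∈ I) :
    #((cubeMod m).filter (fun r => coordElt r ∈ I)) * Ideal.absNorm I = m ^ 3 := by
  classical
  have hI0 : I ≠ ⊥ := by
    intro h
    rw [h, Ideal.mem_bot] at hmI
    have : ((m : ℤ) : 𝓞 K) ≠ 0 := by exact_mod_cast hm.ne'
    exact this hmI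
  haveI : Finite (𝓞 K ⧸ I) := Ideal.finiteQuotientOfFreeOfNeBot I hI0
  letI : Fintype (𝓞 K ⧸ I) := Fintype.ofFinite _
  have hN : Ideal.absNorm I = Fintype.card (𝓞 K ⧸ I) := by
    rw [Ideal.absNorm_apply, Submodule.cardQuot_apply, Nat.card_eq_fintype_card]
  set R := cubeMod m with hR
  set f : ℤ × ℤ × ℤ → 𝓞 K ⧸ I := fun r => Ideal.Quotient.mk I (coordElt r) with hf
  set K₀ := R.filter (fun r => coordElt r ∈ I) with hK₀
  -- every fibre of `f` on `R` has `#K₀` elements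
  have hfib : ∀ q : 𝓞 K ⧸ I, ∃ r₀ ∈ R, f r₀ = q := by
    intro q
    obtain ⟨x, rfl⟩ := Ideal.Quotient.mk_surjective q
    obtain ⟨v, rfl⟩ := coordElt_surjective x
    refine ⟨modVec m v, modVec_mem_cubeMod hm v, ?_⟩
    simp only [hf, Ideal.Quotient.eq]
    -- `coordElt (modVec v) - coordElt v ∈ I`
    obtain ⟨t, ht⟩ := exists_sub_modVec_eq_smul m v
    have : coordElt v - coordElt (modVec m v) ∈ I := by
      rw [← coordElt_sub, ht, coordElt_smul]; exact I.mul_mem_right _ hmI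
    have := I.neg_mem this
    rwa [neg_sub] at this
  have hcardfib : ∀ q : 𝓞 K ⧸ I, #(R.filter (fun r => f r = q)) = #K₀ := by
    intro q
    obtain ⟨r₀, hr₀, rfl⟩ := hfib q
    -- bijection `r ↦ modVec (r - r₀)` from the fibre of `f r₀` onto `K₀`
    refine card_bij (fun r _ => modVec m (r - r₀)) ?_ ?_ ?_
    · intro r hr
      rw [mem_filter] at hr
      rw [hK₀, mem_filter]
      refine ⟨modVec_mem_cubeMod hm _, ?_⟩
      rw [← coordElt_mem_iff_modVec hmI, coordElt_sub, ← Ideal.Quotient.eq]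
      exact hr.2
    · intro r₁ hr₁ r₂ hr₂ h
      rw [mem_filter] at hr₁ hr₂
      -- `modVec (r₁ - r₀) = modVec (r₂ - r₀)` with `r_i ∈ [0,m)³`: then `r₁ ≡ r₂`, both reduced
      obtain ⟨t₁, ht₁⟩ := exists_sub_modVec_eq_smul m (r₁ - r₀)
      obtain ⟨t₂, ht₂⟩ := exists_sub_modVec_eq_smul m (r₂ - r₀)
      have e : r₁ = r₂ + (m : ℤ) • (t₁ - t₂) := by
        have e1 : r₁ - r₀ - (r₂ - r₀) = (m : ℤ) • t₁ - (m : ℤ) • t₂ := by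
          rw [← ht₁, ← ht₂, h]; abel
        rw [smul_sub]
        have : r₁ - r₂ = (m : ℤ) • t₁ - (m : ℤ) • t₂ := by rw [← e1]; abel
        rw [← this]; abel
      have h1 : modVec m r₁ = r₁ := modVec_eq_self_of_mem hr₁.1
      have h2 : modVec m r₂ = r₂ := modVec_eq_self_of_mem hr₂.1
      rw [← h1, ← h2, e, modVec_add_smul]
    · intro r' hr'
      rw [hK₀, mem_filter] at hr'
      refine ⟨modVec m (r' + r₀), ?_, ?_⟩
      · rw [mem_filter]
        refine ⟨modVec_mem_cubeMod hm _, ?_⟩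
        simp only [hf, Ideal.Quotient.eq]
        rw [← coordElt_sub, coordElt_mem_iff_modVec hmI]
        -- `modVec (modVec (r' + r₀) - r₀) = modVec r' = r'`
        obtain ⟨t, ht⟩ := exists_sub_modVec_eq_smul m (r' + r₀)
        have e : modVec m (r' + r₀) - r₀ = r' + (m : ℤ) • (-t) := by
          have : modVec m (r' + r₀) = r' + r₀ - (m : ℤ) • t := by rw [← ht]; abel
          rw [this, smul_neg]; abel
        rw [e, modVec_add_smul, modVec_eq_self_of_mem hr'.1]
        exact hr'.2
      · obtain ⟨t, ht⟩ := exists_sub_modVec_eq_smul m (r' + r₀)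
        have e : modVec m (r' + r₀) - r₀ = r' + (m : ℤ) • (-t) := by
          have : modVec m (r' + r₀) = r' + r₀ - (m : ℤ) • t := by rw [← ht]; abel
          rw [this, smul_neg]; abel
        rw [e, modVec_add_smul, modVec_eq_self_of_mem hr'.1]
  -- sum over the fibres
  have hsum : #R = ∑ q : 𝓞 K ⧸ I, #(R.filter (fun r => f r = q)) :=
    card_eq_sum_card_fiberwise fun r _ => mem_univ (f r)
  have hsum' : #R = Fintype.card (𝓞 K ⧸ I) * #K₀ :=
    calc #R = ∑ q : 𝓞 K ⧸ I, #(R.filter (fun r => f r = q)) := hsum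
      _ = ∑ _q : 𝓞 K ⧸ I, #K₀ := Finset.sum_congr rfl (fun q _ => by convert hcardfib q)
      _ = Fintype.card (𝓞 K ⧸ I) * #K₀ := by rw [sum_const, card_univ, smul_eq_mul]
  rw [hN, mul_comm, ← hsum', hR, card_cubeMod]

/-! ### Counting in lattice cubes -/

/-- The number of integers in `(A, B]` congruent to `v` modulo `m ≥ 1` is at most
`⌊(B − A − 1)/m⌋ + 1` (they form an arithmetic progression of difference `m`). [folklore] -/
theorem card_Ioc_filter_modEq_le (A B : ℤ) {m : ℕ} (hm : 0 < m) (v : ℤ) :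
    #((Ioc A B).filter (fun x => x ≡ v [ZMOD m])) ≤ ((B - A - 1) / m + 1).toNat := by
  classical
  have hm' : (0 : ℤ) < m := by exact_mod_cast hm
  set S := (Ioc A B).filter (fun x => x ≡ v [ZMOD m]) with hS
  have htarget : #(Icc (0 : ℤ) ((B - A - 1) / m)) = ((B - A - 1) / m + 1).toNat := by
    rw [Int.card_Icc, sub_zero]
  rw [← htarget]
  refine card_le_card_of_injOn (fun x => (x - A - 1) / m) ?_ ?_
  · intro x hx
    rw [mem_coe, hS, mem_filter, mem_Ioc] at hx
    rw [mem_coe, mem_Icc]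
    exact ⟨Int.ediv_nonneg (by linarith) hm'.le, Int.ediv_le_ediv hm' (by linarith)⟩
  · intro x hx y hy hxy
    rw [mem_coe, hS, mem_filter, mem_Ioc] at hx hy
    simp only at hxy
    have ex := Int.emod_add_mul_ediv (x - A - 1) m
    have ey := Int.emod_add_mul_ediv (y - A - 1) m
    have hmod : (x - A - 1) % m = (y - A - 1) % m :=
      (Int.ModEq.sub_right _ (Int.ModEq.sub_right _ (hx.2.trans hy.2.symm)))
    rw [hxy, hmod] at ex
    linarith

/-- One side of a lattice cube: the number of integers in `(⌊a⌋, ⌊a + S₀⌋]` congruent to `v` mod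
`m ≥ 1` is at most `⌊S₀⌋/m + 1 ≤ S₀/m + 1` (`S₀ ≥ 0`). [folklore] -/
theorem card_side_filter_modEq_le {a S₀ : ℝ} (hS : 0 ≤ S₀) {m : ℕ} (hm : 0 < m) (v : ℤ) :
    (#((Ioc ⌊a⌋ ⌊a + S₀⌋).filter (fun x => x ≡ v [ZMOD m])) : ℝ) ≤ S₀ / m + 1 := by
  have hm' : (0 : ℤ) < m := by exact_mod_cast hm
  have hmR : (0 : ℝ) < m := by exact_mod_cast hm
  rcases le_or_gt ⌊a + S₀⌋ ⌊a⌋ with hle | _hlt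
  · rw [Finset.Ioc_eq_empty (not_lt.mpr hle), filter_empty, card_empty, Nat.cast_zero]
    positivity
  · have h := card_Ioc_filter_modEq_le ⌊a⌋ ⌊a + S₀⌋ hm v
    have hfl : ⌊a + S₀⌋ - ⌊a⌋ - 1 ≤ ⌊S₀⌋ := by
      have := Int.le_floor_add_floor a S₀
      linarith
    have hq : (⌊a + S₀⌋ - ⌊a⌋ - 1) / (m : ℤ) ≤ ⌊S₀⌋ / (m : ℤ) := Int.ediv_le_ediv hm' hfl
    have hS0 : (0 : ℤ) ≤ ⌊S₀⌋ := Int.floor_nonneg.mpr hS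
    have hq0 : (0 : ℤ) ≤ ⌊S₀⌋ / (m : ℤ) := Int.ediv_nonneg hS0 hm'.le
    have h1 : (((⌊a + S₀⌋ - ⌊a⌋ - 1) / (m : ℤ) + 1).toNat : ℤ) ≤ ⌊S₀⌋ / (m : ℤ) + 1 := by
      rcases le_or_gt 0 ((⌊a + S₀⌋ - ⌊a⌋ - 1) / (m : ℤ) + 1) with h0 | h0
      · rw [Int.toNat_of_nonneg h0]; linarith
      · rw [Int.toNat_eq_zero.mpr h0.le]; push_cast; linarith
    -- `⌊S₀⌋ / m ≤ S₀ / m` as reals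
    have h2 : ((⌊S₀⌋ / (m : ℤ) : ℤ) : ℝ) ≤ S₀ / m := by
      rw [le_div_iff₀ hmR]
      have h3 : ((⌊S₀⌋ / (m : ℤ) : ℤ) : ℝ) * m = ((⌊S₀⌋ / (m : ℤ) * (m : ℤ) : ℤ) : ℝ) := by push_cast; ring
      rw [h3]
      calc ((⌊S₀⌋ / (m : ℤ) * (m : ℤ) : ℤ) : ℝ) ≤ ((⌊S₀⌋ : ℤ) : ℝ) := by
            exact_mod_cast Int.ediv_mul_le _ hm'.ne'
        _ ≤ S₀ := Int.floor_le S₀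
    calc (#((Ioc ⌊a⌋ ⌊a + S₀⌋).filter (fun x => x ≡ v [ZMOD m])) : ℝ)
        ≤ ((((⌊a + S₀⌋ - ⌊a⌋ - 1) / (m : ℤ) + 1).toNat : ℤ) : ℝ) := by exact_mod_cast h
      _ ≤ ((⌊S₀⌋ / (m : ℤ) + 1 : ℤ) : ℝ) := by exact_mod_cast h1
      _ ≤ S₀ / m + 1 := by push_cast; linarith

/-- The fibre of `modVec m` over `r ∈ [0, m)³` inside a lattice cube is a product of three
arithmetic progressions. [folklore] -/
theorem filter_modVec_eq_subset {m : ℕ} (a : ℝ × ℝ × ℝ) (S₀ : ℝ) (r : ℤ × ℤ × ℤ) :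
    (latticeCube a S₀).filter (fun v => modVec m v = r) ⊆
      (Ioc ⌊a.1⌋ ⌊a.1 + S₀⌋).filter (fun x => x ≡ r.1 [ZMOD m]) ×ˢ
        ((Ioc ⌊a.2.1⌋ ⌊a.2.1 + S₀⌋).filter (fun x => x ≡ r.2.1 [ZMOD m]) ×ˢ
          (Ioc ⌊a.2.2⌋ ⌊a.2.2 + S₀⌋).filter (fun x => x ≡ r.2.2 [ZMOD m])) := by
  intro v hv
  rw [mem_filter, latticeCube, mem_product, mem_product] at hv
  obtain ⟨⟨h1, h2, h3⟩, hr⟩ := hv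
  simp only [modVec, Prod.ext_iff] at hr
  obtain ⟨e1, e2, e3⟩ := hr
  simp only [mem_product, mem_filter, Int.ModEq]
  refine ⟨⟨h1, ?_⟩, ⟨h2, ?_⟩, ⟨h3, ?_⟩⟩
  · rw [← e1, Int.emod_emod_of_dvd _ (dvd_refl _)]
  · rw [← e2, Int.emod_emod_of_dvd _ (dvd_refl _)]
  · rw [← e3, Int.emod_emod_of_dvd _ (dvd_refl _)]

/-- **Box count for a periodic property.** If `P` is `m`-periodic on `ℤ³` (`m ≥ 1`), then in a lattice
cube of side `S₀ ≥ 0` it holds at no more than `#{r ∈ [0,m)³ : P r} · (S₀/m + 1)³` points. [folklore] -/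
theorem card_latticeCube_filter_le {m : ℕ} (hm : 0 < m) (P : ℤ × ℤ × ℤ → Prop) [DecidablePred P]
    (hP : ∀ v t : ℤ × ℤ × ℤ, P (v + (m : ℤ) • t) ↔ P v) (a : ℝ × ℝ × ℝ) {S₀ : ℝ} (hS : 0 ≤ S₀) :
    (#((latticeCube a S₀).filter P) : ℝ) ≤ #((cubeMod m).filter P) * (S₀ / m + 1) ^ 3 := by
  classical
  set s := (latticeCube a S₀).filter P with hs
  -- periodicity in the form `P (modVec v) ↔ P v`
  have hPmod : ∀ v, P (modVec m v) ↔ P v := by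
    intro v
    obtain ⟨t, ht⟩ := exists_sub_modVec_eq_smul m v
    have : v = modVec m v + (m : ℤ) • t := by rw [← ht]; abel
    conv_rhs => rw [this]
    exact (hP _ _).symm
  -- fibres of `modVec` on `s`
  set b : ℝ := S₀ / m + 1 with hb
  have hb0 : 0 ≤ b := by positivity
  have hfib : ∀ r ∈ s.image (modVec m), (#(s.filter (fun v => modVec m v = r)) : ℝ) ≤ b ^ 3 := by
    intro r _
    have hsub : s.filter (fun v => modVec m v = r) ⊆
        (latticeCube a S₀).filter (fun v => modVec m v = r) := by
      intro v hv
      rw [mem_filter] at hv ⊢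
      exact ⟨(mem_filter.mp hv.1).1, hv.2⟩
    calc (#(s.filter (fun v => modVec m v = r)) : ℝ)
        ≤ #((latticeCube a S₀).filter (fun v => modVec m v = r)) := by
          exact_mod_cast card_le_card hsub
      _ ≤ #((Ioc ⌊a.1⌋ ⌊a.1 + S₀⌋).filter (fun x => x ≡ r.1 [ZMOD m]) ×ˢ
            ((Ioc ⌊a.2.1⌋ ⌊a.2.1 + S₀⌋).filter (fun x => x ≡ r.2.1 [ZMOD m]) ×ˢ
              (Ioc ⌊a.2.2⌋ ⌊a.2.2 + S₀⌋).filter (fun x => x ≡ r.2.2 [ZMOD m]))) := by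
          exact_mod_cast card_le_card (filter_modVec_eq_subset a S₀ r)
      _ = #((Ioc ⌊a.1⌋ ⌊a.1 + S₀⌋).filter (fun x => x ≡ r.1 [ZMOD m])) *
            (#((Ioc ⌊a.2.1⌋ ⌊a.2.1 + S₀⌋).filter (fun x => x ≡ r.2.1 [ZMOD m])) *
              #((Ioc ⌊a.2.2⌋ ⌊a.2.2 + S₀⌋).filter (fun x => x ≡ r.2.2 [ZMOD m]))) := by
          rw [card_product, card_product]; push_cast; ring
      _ ≤ b * (b * b) := by
          have h1 := card_side_filter_modEq_le (a := a.1) hS hm r.1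
          have h2 := card_side_filter_modEq_le (a := a.2.1) hS hm r.2.1
          have h3 := card_side_filter_modEq_le (a := a.2.2) hS hm r.2.2
          exact mul_le_mul h1 (mul_le_mul h2 h3 (by positivity) hb0) (by positivity) hb0
      _ = b ^ 3 := by ring
  -- `#s ≤ (max fibre) * #image` in the real form
  have himg : s.image (modVec m) ⊆ (cubeMod m).filter P := by
    intro r hr
    obtain ⟨v, hv, rfl⟩ := mem_image.mp hr
    rw [mem_filter]
    exact ⟨modVec_mem_cubeMod hm v, (hPmod v).mpr (mem_filter.mp hv).2⟩
  have hdecomp : (#s : ℝ) = ∑ r ∈ s.image (modVec m), (#(s.filter (fun v => modVec m v = r)) : ℝ) := by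
    have := card_eq_sum_card_image (modVec m) s
    exact_mod_cast this
  calc (#s : ℝ) = ∑ r ∈ s.image (modVec m), (#(s.filter (fun v => modVec m v = r)) : ℝ) := hdecomp
    _ ≤ ∑ _r ∈ s.image (modVec m), b ^ 3 := sum_le_sum hfib
    _ = #(s.image (modVec m)) * b ^ 3 := by rw [sum_const, nsmul_eq_mul]
    _ ≤ #((cubeMod m).filter P) * b ^ 3 :=
        mul_le_mul_of_nonneg_right (by exact_mod_cast card_le_card himg) (by positivity)

open scoped Classical in
/-- **The count of p. 23: `#{β̂ ∈ 𝒞 : β ∈ I} ≤ N(I)² (S₀/N(I) + 1)³`** for a non-zero ideal `I` and a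
lattice cube `𝒞` of side `S₀ ≥ 0` ("if `𝒞'` is a cube of side `N(I)`, then there are `O(N(I)²)` values
of `β ∈ 𝒞'` for which `I ∣ β`"). [cite: HeathBrownActa2001, Lemma 4.5] -/
theorem card_latticeCube_filter_mem_le {I : Ideal (𝓞 K)} (hI : I ≠ ⊥) (a : ℝ × ℝ × ℝ) {S₀ : ℝ}
    (hS : 0 ≤ S₀) :
    (#((latticeCube a S₀).filter (fun v => coordElt v ∈ I)) : ℝ) ≤
      (Ideal.absNorm I : ℝ) ^ 2 * (S₀ / Ideal.absNorm I + 1) ^ 3 := by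
  classical
  set N := Ideal.absNorm I with hN
  have hN0 : 0 < N := Nat.pos_of_ne_zero (by rw [hN, Ne, Ideal.absNorm_eq_zero_iff]; exact hI)
  have hNI : ((N : ℤ) : 𝓞 K) ∈ I := by
    rw [Int.cast_natCast, hN]; exact Ideal.absNorm_mem I
  have hP : ∀ v t : ℤ × ℤ × ℤ, coordElt (v + (N : ℤ) • t) ∈ I ↔ coordElt v ∈ I := fun v t =>
    coordElt_mem_iff_of_sub_eq_smul hNI (by abel)
  have hbox := card_latticeCube_filter_le hN0 (fun v => coordElt v ∈ I) hP a hS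
  have hK : #((cubeMod N).filter (fun r => coordElt r ∈ I)) = N ^ 2 := by
    have h := card_cubeMod_filter_mem_mul_absNorm hN0 hNI
    rw [← hN] at h
    have : #((cubeMod N).filter (fun r => coordElt r ∈ I)) * N = N ^ 2 * N := by rw [h]; ring
    exact Nat.eq_of_mul_eq_mul_right hN0 this
  rw [hK] at hbox
  push_cast at hbox
  exact hbox

open scoped Classical in
/-- For `1 ≤ N(I) ≤ S₀` the count is `≤ 8 S₀³/N(I)`. [cite: HeathBrownActa2001, Lemma 4.5] -/
theorem card_latticeCube_filter_mem_le' {I : Ideal (𝓞 K)} (hI : I ≠ ⊥) (a : ℝ × ℝ × ℝ) {S₀ : ℝ}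
    (hS : (Ideal.absNorm I : ℝ) ≤ S₀) :
    (#((latticeCube a S₀).filter (fun v => coordElt v ∈ I)) : ℝ) ≤
      8 * S₀ ^ 3 / Ideal.absNorm I := by
  have hN0 : 0 < Ideal.absNorm I :=
    Nat.pos_of_ne_zero (by rw [Ne, Ideal.absNorm_eq_zero_iff]; exact hI)
  have hN : (1 : ℝ) ≤ Ideal.absNorm I := by exact_mod_cast hN0
  have hNpos : (0 : ℝ) < Ideal.absNorm I := by linarith
  have hS0 : 0 ≤ S₀ := by linarith
  refine (card_latticeCube_filter_mem_le hI a hS0).trans ?_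
  have h1 : S₀ / Ideal.absNorm I + 1 ≤ 2 * (S₀ / Ideal.absNorm I) := by
    have : 1 ≤ S₀ / Ideal.absNorm I := by rw [le_div_iff₀ hNpos, one_mul]; exact hS
    linarith
  calc (Ideal.absNorm I : ℝ) ^ 2 * (S₀ / Ideal.absNorm I + 1) ^ 3
      ≤ (Ideal.absNorm I : ℝ) ^ 2 * (2 * (S₀ / Ideal.absNorm I)) ^ 3 := by
        gcongr
    _ = 8 * S₀ ^ 3 / Ideal.absNorm I := by
        field_simp
        ring

end Literature.NumberTheory.Sieve.CubicSieve

end
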